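import Literature.NumberTheory.Automorphic.LanglandsTunnellReduction
import Literature.NumberTheory.Automorphic.LanglandsTunnellModThree
import Literature.NumberTheory.GaloisRepresentations.ArtinCharacterReciprocityProofs
import Literature.NumberTheory.Automorphic.TunnellOctahedralGlobalProofs
import Literature.NumberTheory.Automorphic.PiOfArtinRepFrobSatakeCompatibleProofs
import Literature.NumberTheory.Automorphic.BCDTTheoremB
import Literature.NumberTheory.GaloisRepresentations.SerreOpenImageGroupLemmas
import Literature.NumberTheory.GaloisRepresentations.AbsGaloisGroup
import Literature.NumberTheory.GaloisRepresentations.ProjectiveType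
import Literature.NumberTheory.GaloisRepresentations.GL2F3Lift
import Literature.NumberTheory.EllipticCurves.CMNewformGamma0PrimitiveIsNewformHolds
import Mathlib.GroupTheory.PGroup
import HarnessLib

/-!
# stub-ideation k2 · generation 15 · `stub_modThree` (S1a) — companion to `STUB-IDEAS-stub_modThree-2.md`

HOME = FAMILY 2 (RESHAPE).  Nothing here is registered; `Lines/Sketch.lean` is untouched.
This file has NO `sorry`.  Contents:

* §1 `SigStubModThree` (registered stub verbatim), its two regime cells `SigStubModThreeSurj`
  (octahedral / surjective) and `SigStubModThreeTwoGroup` (2-group image), and the DISPATCH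
  `stubModThree_of_split : SigStubModThreeSurj → SigStubModThreeTwoGroup → SigStubModThree`
  kernel-checked from TREE lemmas only (H0 oddness; N1 = Serre's "`3 ∣ #G` ⇒ all or Borel" +
  `#GL₂(𝔽₃) = 48`; proofs of H0/N1a/N1b/N1 are ideator k1's, gen-2/gen-6 companions, repeated so
  that this one file checks), plus the converse `split_iff`.  (k3 g14 has the same dispatch through
  the cube criterion `Δ ∈ ℚ×³`; this is the image-theoretic road, in the currency `IsPGroup 2` of
  k1's bricks E0–E5.)
* §2 plan of record R1 for the surjective cell, re-checked against today's tree: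
  `stubModThreeSurj_of_open_leaves` / `stubModThree_of_open_leaves` from the EIGHT open
  Langlands–Tunnell leaves (unchanged since gen 11); `twoGroup_namedFact_holds` records that the
  2-group cell's last named fact (`shimura1972_heckeTheta_isNewform0_of_primitive`) is now a tree
  THEOREM (2026-09-01).
* §3 `Cert.*` — kernel certificates (`decide`) behind this generation's two reshape probes:
  T14 (Galois-closure detour for the cubic lift `hb`): place combinatorics in `S₄ = PGL₂(𝔽₃)` —
  an odd Frobenius fixes exactly one of the three pairings (one degree-1 place `w₁` of the cubic
  field `K`, inert in `M = K(√-3)`); T15 (parity ⟺ local correctness): exponent arithmetic in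
  `μ₈` (model `ZMod 8`, complex conjugation = inversion) — for a quadratic descent `Π` of `π(σ_E)`,
  ODD central character pins the Satake pair at every inert place up to ONE global sign, EVEN
  central character makes it real-trace (`±√2`) at every order-8 Frobenius.
-/

open scoped MatrixGroups NumberField
open Literature.NumberTheory.EllipticCurves
open Literature.NumberTheory.EllipticCurves.ModularForms
open Literature.NumberTheory.Automorphic
open Literature.NumberTheory.Automorphic.BCDT
open Literature.NumberTheory.GaloisRepresentations
open Literature.NumberTheory.GaloisRepresentations.GL2F3Lift
open WeierstrassCurve Matrix

set_option linter.dupNamespace false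

noncomputable section

namespace Summit.ABC.ABC.Cruxes.FreyModularity.StubModThreeIdeasK2G15

/-! ## §1 The stub, its two regime cells, and the dispatch -/

/-- The registered stub `stub_modThree`, verbatim (`Lines/Sketch.lean` l.143). -/
def SigStubModThree : Prop :=
  ∀ (W : WeierstrassCurve ℚ) [W.IsElliptic] (ρ : ModPGaloisRep ℚ (ZMod 3) 2),
    W.IsTorsionGaloisRep 3 ρ → FramedRep.IsAbsolutelyIrreducible ρ → ρ.IsModular

/-- Surjective (octahedral) cell — Tunnell's case; FROZEN on R1's eight leaves (= k1/k3 `StubModThreeSurj`). -/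
def SigStubModThreeSurj : Prop :=
  ∀ (W : WeierstrassCurve ℚ) [W.IsElliptic] (ρ : ModPGaloisRep ℚ (ZMod 3) 2),
    W.IsTorsionGaloisRep 3 ρ → Function.Surjective ρ → ρ.IsModular

/-- 2-group cell (image a 2-group, i.e. in the normaliser of a non-split Cartan) — k1's `TwoGroupBranch`. -/
def SigStubModThreeTwoGroup : Prop :=
  ∀ (W : WeierstrassCurve ℚ) [W.IsElliptic] (ρ : ModPGaloisRep ℚ (ZMod 3) 2),
    W.IsTorsionGaloisRep 3 ρ → FramedRep.IsAbsolutelyIrreducible ρ →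
    IsPGroup 2 ρ.toMonoidHom.range → ρ.IsModular

/-- **H0** (PROVED; k1 gen-2): `ρ̄_{E,3}` is odd (`det ρ̄ = χ₃`, Weil pairing, tree theorem). -/
theorem isOdd_of_isTorsionGaloisRep_three (W : WeierstrassCurve ℚ) [W.IsElliptic]
    (ρ : ModPGaloisRep ℚ (ZMod 3) 2) (hρ : W.IsTorsionGaloisRep 3 ρ) :
    FramedGaloisRep.IsOdd ρ := by
  haveI : NeZero ((3 : ℕ) : ℚ) := ⟨by norm_num⟩
  intro φ c hc
  rw [W.det_eq_modPCyclotomicCharacter_of_isTorsionGaloisRep_holds 3 ρ hρ c]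
  ext
  rw [modPCyclotomicCharacterZMod_eq_modNCyclotomicCharacter,
    modNCyclotomicCharacter_of_isComplexConjugation hc, Units.val_neg, Units.val_one]

/-- **N1a** (PROVED; k1 gen-6): an odd `ρ̄ : Γ_ℚ → GL₂(𝔽₃)` has `det` onto `{±1}` on its image. -/
theorem det_surjOn_range_of_isOdd (ρ : ModPGaloisRep ℚ (ZMod 3) 2) (hodd : FramedGaloisRep.IsOdd ρ) :
    ∀ u : (ZMod 3)ˣ, ∃ g ∈ ρ.toMonoidHom.range, Matrix.GeneralLinearGroup.det g = u := by
  obtain ⟨c, hc⟩ := exists_isComplexConjugation (Rat.castHom ℝ)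
  have hc' : Matrix.GeneralLinearGroup.det (ρ c) = -1 := hodd (Rat.castHom ℝ) c hc
  intro u
  obtain rfl | rfl : u = 1 ∨ u = -1 := by revert u; decide
  · exact ⟨1, one_mem _, map_one _⟩
  · exact ⟨ρ c, ⟨c, rfl⟩, hc'⟩

/-- **N1b** (PROVED; k1 gen-6): an irreducible `ρ̄` has image in no Borel subgroup. -/
theorem not_range_le_eigenvectorStabilizer (ρ : ModPGaloisRep ℚ (ZMod 3) 2)
    (hirr : FramedRep.IsIrreducible ρ) (v : Fin 2 → ZMod 3) (hv : v ≠ 0) :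
    ¬ ρ.toMonoidHom.range ≤ eigenvectorStabilizer v hv := by
  intro hle
  have key : ∀ g : Field.absoluteGaloisGroup ℚ, ∃ a : ZMod 3,
      ((ρ g : GL (Fin 2) (ZMod 3)) : Matrix (Fin 2) (Fin 2) (ZMod 3)) *ᵥ v = a • v :=
    fun g ↦ mem_eigenvectorStabilizer_iff.mp (hle ⟨g, rfl⟩)
  have hirr' : IsSimpleOrder (Subrepresentation (FramedRep.toRepresentation ρ)) := hirr
  let S : Subrepresentation (FramedRep.toRepresentation ρ) :=
    { toSubmodule := (ZMod 3) ∙ v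
      apply_mem_toSubmodule := by
        intro g w hw
        obtain ⟨b, rfl⟩ := Submodule.mem_span_singleton.mp hw
        obtain ⟨a, ha⟩ := key g
        rw [FramedRep.toRepresentation_apply_apply, Matrix.mulVec_smul, ha, smul_smul]
        exact Submodule.mem_span_singleton.mpr ⟨b * a, rfl⟩ }
  rcases hirr'.eq_bot_or_eq_top S with hS | hS
  · have hvS : v ∈ S := Submodule.mem_span_singleton_self v
    rw [hS] at hvS
    exact hv ((Submodule.mem_bot (ZMod 3)).mp hvS)
  · have h1 : Module.finrank (ZMod 3) ((ZMod 3) ∙ v) = 1 := finrank_span_singleton hv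
    have h2 : ((ZMod 3) ∙ v : Submodule (ZMod 3) (Fin 2 → ZMod 3)) = ⊤ :=
      congrArg Subrepresentation.toSubmodule hS
    rw [h2, finrank_top, Module.finrank_fin_fun] at h1
    exact absurd h1 (by norm_num)

/-- **N1** (PROVED; k1 gen-6): `ρ̄` irreducible and odd ⇒ `ρ̄` surjective or its image is a `2`-group
(Serre: a subgroup of `GL₂(𝔽₃)` of order divisible by `3` with `det` onto is `GL₂(𝔽₃)` or Borel). -/
theorem surjective_or_isPGroup_two (ρ : ModPGaloisRep ℚ (ZMod 3) 2)
    (hirr : FramedRep.IsIrreducible ρ) (hodd : FramedGaloisRep.IsOdd ρ) :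
    Function.Surjective ρ ∨ IsPGroup 2 ρ.toMonoidHom.range := by
  classical
  haveI : Fact (Nat.Prime 3) := ⟨Nat.prime_three⟩
  set G := ρ.toMonoidHom.range with hG
  by_cases hs : Function.Surjective ρ
  · exact Or.inl hs
  refine Or.inr ?_
  have h3 : ¬ 3 ∣ Nat.card G := by
    intro h
    rcases Serre1972.eq_top_or_borel_of_dvd_card G h (det_surjOn_range_of_isOdd ρ hodd) with
      htop | ⟨v, hv, hle⟩
    · exact hs (MonoidHom.range_eq_top.mp htop)
    · exact not_range_le_eigenvectorStabilizer ρ hirr v hv hle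
  have h48 : Nat.card G ∣ 2 ^ 4 * 3 := by
    have h := Subgroup.card_subgroup_dvd_card G
    rwa [card_GL_fin_two_zmod_three] at h
  have h16 : Nat.card G ∣ 2 ^ 4 :=
    Nat.Coprime.dvd_of_dvd_mul_right ((Nat.Prime.coprime_iff_not_dvd Nat.prime_three).mpr h3).symm h48
  obtain ⟨k, -, hk⟩ := (Nat.dvd_prime_pow Nat.prime_two).1 h16
  exact IsPGroup.of_card hk

/-- **DISPATCH** (PROVED): the stub from its two regime cells.  The surjective cell needs no
irreducibility hypothesis of its own (`isAbsIrreducibleOverSqrt_neg_three_of_surjective`, BCDT §2.2,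
tree theorem) and the split is exhaustive by H0 + N1. -/
theorem stubModThree_of_split (hS : SigStubModThreeSurj) (hT : SigStubModThreeTwoGroup) :
    SigStubModThree := by
  intro W _ ρ hρ habs
  rcases surjective_or_isPGroup_two ρ habs.isIrreducible (isOdd_of_isTorsionGaloisRep_three W ρ hρ)
    with hs | h2
  · exact hS W ρ hρ hs
  · exact hT W ρ hρ habs h2

/-- Converse bookkeeping: the stub gives back both cells (so the re-cut loses nothing). -/
theorem split_iff : SigStubModThree ↔ (SigStubModThreeSurj ∧ SigStubModThreeTwoGroup) := by
  refine ⟨fun h ↦ ⟨fun W _ ρ hρ hs ↦ ?_, fun W _ ρ hρ habs _ ↦ h W ρ hρ habs⟩,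
    fun h ↦ stubModThree_of_split h.1 h.2⟩
  exact h W ρ hρ (isAbsIrreducibleOverSqrt_neg_three_of_surjective ρ hs).isAbsolutelyIrreducible

/-! ## §2 Plan of record R1 for the surjective cell (re-checked) -/

/-- **R1** (PROVED, re-checked 2026-09-01 g15): the WHOLE stub from the eight open Langlands–Tunnell
leaves; the discharged leaves (`artinReciprocity_character_holds`, `exists_twist_quadraticSign_holds`,
`frobSatakeCompatibleAt_of_isPiOfArtinRep_holds`) are supplied from the tree. -/
theorem stubModThree_of_open_leaves
    (hAI : automorphicInduction_character)
    (hdesc3 : exists_cuspidal_descent_det_cubic) (hGJ : GelbartJacquet_adjoint_lift)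
    (hJS : JacquetShalika_eq_of_rsData_eq) (hdesc : cuspidal_descent_cyclic)
    (ha : ArthurClozel_fibres_quadratic) (hb : tunnell_cuspidal_cubic_lifts)
    (hW1 : exists_isNewform1_of_isPiOfArtinRep) : SigStubModThree :=
  fun W _ ρ hρ habs ↦
    W.isModular_of_isTorsionGaloisRep_three_of_langlands_tunnell
      (langlands_tunnell_of_leaves artinReciprocity_character_holds hAI hdesc3 hGJ hJS hdesc
        exists_twist_quadraticSign_holds ha hb frobSatakeCompatibleAt_of_isPiOfArtinRep_holds hW1)
      ρ hρ habs

/-- **R1 restricted to the surjective cell** (PROVED): what the reshape leaves frozen. -/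
theorem stubModThreeSurj_of_open_leaves
    (hAI : automorphicInduction_character)
    (hdesc3 : exists_cuspidal_descent_det_cubic) (hGJ : GelbartJacquet_adjoint_lift)
    (hJS : JacquetShalika_eq_of_rsData_eq) (hdesc : cuspidal_descent_cyclic)
    (ha : ArthurClozel_fibres_quadratic) (hb : tunnell_cuspidal_cubic_lifts)
    (hW1 : exists_isNewform1_of_isPiOfArtinRep) : SigStubModThreeSurj :=
  (split_iff.mp (stubModThree_of_open_leaves hAI hdesc3 hGJ hJS hdesc ha hb hW1)).1

/-- The 2-group cell's last named Literature fact is a tree THEOREM since 2026-09-01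
(`CMNewformGamma0PrimitiveIsNewformHolds`): k1's bricks E0–E5 are all that cell still owes. -/
theorem twoGroup_namedFact_holds : shimura1972_heckeTheta_isNewform0_of_primitive :=
  shimura1972_heckeTheta_isNewform0_of_primitive_holds

/-! ## §3 Kernel certificates for the reshape probes T14 / T15 -/

namespace Cert

open Equiv

/-- The three pairings of `Fin 4` as double transpositions (`V₄ ∖ {1}`); `S₄/V₄ ≅ S₃` permutes them,
and the cubic field `K ⊂ ℚ(σ)` is the fixed field of the stabiliser of one of them. -/
def d1 : Perm (Fin 4) := swap 0 1 * swap 2 3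
def d2 : Perm (Fin 4) := swap 0 2 * swap 1 3
def d3 : Perm (Fin 4) := swap 0 3 * swap 1 2

/-- `g` fixes exactly one of the three pairings (⟺ over a place with Frobenius `g`, the cubic field
`K` has exactly one place of residue degree `1`). -/
def FixesExactlyOne (g : Perm (Fin 4)) : Prop :=
  (g * d1 = d1 * g ∧ g * d2 ≠ d2 * g ∧ g * d3 ≠ d3 * g) ∨
  (g * d1 ≠ d1 * g ∧ g * d2 = d2 * g ∧ g * d3 ≠ d3 * g) ∨
  (g * d1 ≠ d1 * g ∧ g * d2 ≠ d2 * g ∧ g * d3 = d3 * g)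

instance (g : Perm (Fin 4)) : Decidable (FixesExactlyOne g) := by
  unfold FixesExactlyOne; infer_instance

set_option maxRecDepth 100000 in
/-- **T14 (a)**: a TRANSPOSITION (`g² = 1`, `g ∉ V₄`) fixes exactly one pairing — over a place `v`
inert in `E` with Frobenius a reflection, `K` has one degree-1 place `w₁` (and one of degree 2). -/
theorem transposition_fixes_one :
    ∀ g : Perm (Fin 4), g * g = 1 → g ≠ 1 → g ≠ d1 → g ≠ d2 → g ≠ d3 → FixesExactlyOne g := by
  decide

set_option maxRecDepth 100000 in
/-- **T14 (b)**: a `4`-CYCLE (`g⁴ = 1`, `g² ≠ 1`) fixes exactly one pairing — same splitting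
`v = w₁ w₂` in `K` for the order-8 Frobenius classes (density `1/4`). -/
theorem fourCycle_fixes_one :
    ∀ g : Perm (Fin 4), g * g * (g * g) = 1 → g * g ≠ 1 → FixesExactlyOne g := by
  decide

set_option maxRecDepth 100000 in
/-- **T14 (c)**: in both odd cases `g ∉ V₄`, i.e. the image of `Frob_v = Frob_{w₁}` in
`Gal(M/K) ≤ S₄/V₄` is non-trivial: `w₁` is INERT in `M = K·E`, so quadratic descent `M → K`
leaves the Satake pair at `w₁` undetermined up to sign — exactly where Tunnell uses `hb`. -/
theorem odd_not_mem_klein :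
    ∀ g : Perm (Fin 4), (g * g = 1 ∧ g ≠ 1 ∧ g ≠ d1 ∧ g ≠ d2 ∧ g ≠ d3) ∨
      (g * g * (g * g) = 1 ∧ g * g ≠ 1) → g ≠ 1 ∧ g ≠ d1 ∧ g ≠ d2 ∧ g ≠ d3 := by
  decide

/-! ### T15 — exponent model of `μ₈`: `α = ζ₈^x`, squaring `x ↦ 2x`, complex conjugation
`x ↦ -x`, `-α ↔ x + 4`; `ζ₈ + ζ₈³ = √-2`, `ζ₈ + ζ₈⁷ = √2`. At a place `v` inert in `E = ℚ(√-3)`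
the descent `Π` of `π(σ_E)` has unitary Satake pair `{α, β}` with `{α², β²} = ev σ(Frob_v)²`;
`Π^∨ ≅ Π ⊗ ω_Π⁻¹` reads `{ᾱ, β̄} = {-α, -β}` if `ω_Π = ω_E` (ODD) and `{ᾱ, β̄} = {α, β}` if
`ω_Π = 1` (EVEN). -/

/-- **T15 (odd, order-8 Frobenius)**: `{α², β²} = {i, -i}` and `{ᾱ, β̄} = {-α, -β}` force
`{α, β} = {ζ₈, ζ₈³}` or `{ζ₈⁵, ζ₈⁷}`: trace `±√-2` = `tr σ(Frob_v)` up to ONE sign. -/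
theorem order8_odd :
    ∀ x y : ZMod 8, ((2 * x = 2 ∧ 2 * y = 6) ∨ (2 * x = 6 ∧ 2 * y = 2)) →
      ((-x = x + 4 ∧ -y = y + 4) ∨ (-x = y + 4 ∧ -y = x + 4)) →
      ((x = 1 ∧ y = 3) ∨ (x = 3 ∧ y = 1) ∨ (x = 5 ∧ y = 7) ∨ (x = 7 ∧ y = 5)) := by
  decide

/-- **T15 (even, order-8 Frobenius)**: `{ᾱ, β̄} = {α, β}` forces `{α, β} = {ζ₈, ζ₈⁷}` or
`{ζ₈³, ζ₈⁵}`: REAL trace `±√2 ≠ ±√-2` — an even descent is wrong at EVERY order-8 place. -/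
theorem order8_even :
    ∀ x y : ZMod 8, ((2 * x = 2 ∧ 2 * y = 6) ∨ (2 * x = 6 ∧ 2 * y = 2)) →
      ((-x = x ∧ -y = y) ∨ (-x = y ∧ -y = x)) →
      ((x = 1 ∧ y = 7) ∨ (x = 7 ∧ y = 1) ∨ (x = 3 ∧ y = 5) ∨ (x = 5 ∧ y = 3)) := by
  decide

/-- **T15 (odd, reflection Frobenius)**: `α² = β² = 1` and `{ᾱ, β̄} = {-α, -β}` force
`{α, β} = {1, -1}` = `ev σ(Frob_v)` — NO sign ambiguity at reflections (trace `0`). -/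
theorem reflection_odd :
    ∀ x y : ZMod 8, (2 * x = 0 ∧ 2 * y = 0) →
      ((-x = x + 4 ∧ -y = y + 4) ∨ (-x = y + 4 ∧ -y = x + 4)) →
      ((x = 0 ∧ y = 4) ∨ (x = 4 ∧ y = 0)) := by
  decide

/-- **T15 (even, reflection Frobenius)**: unpinned — `{1, 1}` survives. -/
theorem reflection_even_unpinned :
    ∃ x y : ZMod 8, (2 * x = 0 ∧ 2 * y = 0) ∧ ((-x = x ∧ -y = y) ∨ (-x = y ∧ -y = x)) ∧
      ¬ ((x = 0 ∧ y = 4) ∨ (x = 4 ∧ y = 0)) :=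
  ⟨0, 0, by decide⟩

end Cert

end Summit.ABC.ABC.Cruxes.FreyModularity.StubModThreeIdeasK2G15

end
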